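import Mathlib
import HarnessLib
import Literature.Combinatorics.Additive.StepBeyondKempermanSeventeenExcluded
import Literature.Combinatorics.Additive.StepBeyondKempermanClaimNineExclusions
import Literature.Combinatorics.Additive.StepBeyondKempermanThreeFour
import Literature.Combinatorics.Additive.StepBeyondKempermanTypes
import Literature.Combinatorics.Additive.StepBeyondKempermanComplementProgressions

/-!
# Grynkiewicz 2009, §6 Claims 9 and 10: «w.l.o.g. `|A| ≥ |B| ≥ 4`» and «`|\overline{A + B}| ≥ 4`» — the
# cases `|A| = 3` and `|\overline{A + B}| = 3` of the deep core are impossible (modulo the theorem for the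
# smaller pairs `(A, B ∖ b)` resp. `(−B, \overline{A + B})`)

[cite: Grynkiewicz2009, §6 Claims 9–10 (proof of Thm 4.1, pp. 28–29)] [tag: critical-pair] [tag: inverse-theorem]

Topic `Literature/Combinatorics/Additive`.  Cell `mm-stpp` (D-0046), seat `mm-stpp-lit` (gen 24); the
port of D. J. Grynkiewicz, *A step beyond Kemperman's structure theorem*, Mathematika **55** (2009)
67–114 continued.  §6, CASE I, **Claim 9** (print pp. 28–29):

«Claim 9: w.l.o.g. `|A| ≥ |B| ≥ 4`.  Suppose `|A| = 3`.  Hence `|B|, |\overline{A + B}| ≥ 4` as noted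
above.  If `|N₁ᵇ(A, B)| = 0` for all `b ∈ B`, then Lemma 5.11 … implies `|B| ≥ |G| − 6`, whence
`|\overline{A + B}| ≤ 3`, a contradiction.  Therefore, since `|N₁ᵇ(A, B)| ≤ 1` for all `b ∈ B` (Claim 8),
it follows that we can assume `|N₁ᵇ(A, B)| = 1` for some `b ∈ B` … We proceed by induction on `|B|` …
Since `|N₁ᵇ(A, B)| = 1`, and since `A + B` is not quasi-periodic (eq. (45)), it follows that
`A + (B ∖ b) = (A + B) ∖ γ` is aperiodic with `γ ∈ A + B`.  Suppose (17) holds for `A` and `B ∖ b`. …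
both contradictions (to Claim 5 or (51)).  Therefore we can assume (17) does not hold. … Thus we can
apply the induction hypothesis to the pair `(A, B ∖ b)` and assume (17) does not hold.  Hence, since
`⟨A⟩ = G` and since `A` is not quasi-periodic (Claim 4), it follows that `H = G` in Theorem 4.1.  Thus,
since `|A|, |B ∖ b| ≥ 3`, since `|\overline{A + (B ∖ b)}| ≥ 4` (Claim 5), and since `d⊆(A, QP) ≥ 2`
(eq. (47)), it follows that we must have type (VI) with `H = G` (note type (VII) with `H = G` would imply
`|\overline{A + (B ∖ b)}| = 3`, while type (VIII) would imply `d⊆(A, QP) = 1`), whence `|B| = 4` and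
w.l.o.g. `A = {0, d, x}` and `B = {0, d, x, b}` with `N₁ᵇ(A, B) = {x + b}`. … all contradictions,
completing the induction.  So `|A| ≥ 4`.»  (Overlines restored from the arXiv version; the printed
«`|A + B| ≥ 4`» etc. are complements.)

HOW IT IS MIRRORED (`Grynkiewicz2009.claim9`).
* Lemma 5.11 = the tree's `finite_and_card_le_of_two_le_addConvolution`; «`|N₁ᵇ(A, B)| = 1`» via
  `card_layerWith_one_singleton`; `A + (B ∖ b) = (A + B) ∖ N₁ᵇ` via `add_nsmul_add_sdiff_eq`.
* «`A + (B ∖ b) = (A + B) ∖ γ` is aperiodic»: `addStab_eq_bot_of_card_sdiff_le_one` (a private copy of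
  `Grynkiewicz2009.addStab_eq_of_card_sdiff_le_one` of `StepBeyondKempermanSubcaseThree.lean`, inlined to keep
  this file's import closure small)
  (`StepBeyondKempermanSubcaseThree.lean`).
* «Suppose (17) holds … Therefore we can assume (17) does not hold»:
  `not_seventeen_of_two_le_subsetDist` (`StepBeyondKempermanSeventeenExcluded.lean`; with Corollary 4.2's
  first assertion and KST inside).
* THE INDUCTION HYPOTHESIS is the hypothesis `IH`: Theorem 4.1's conclusion for each pair `(A, B ∖ b)`
  with `|A + (B ∖ b)| = |A| + |B ∖ b|` and `A + (B ∖ b)` aperiodic.  (The print restricts its induction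
  domain to non-quasi-periodic generating `B ∖ b`, using Lemma 5.4 and «w.l.o.g. `b ≠ 0`»; taking the
  theorem for `(A, B ∖ b)` outright is the same input in the global induction on `|A| + |B|` for pairs
  with `min{|A|, |B|} = 3`, and dispenses with the translation.)
* «`H = G` in Theorem 4.1»: `IsGrynkiewiczDecomp.eq_top_of_subset` (as for KST,
  `IsKempermanDecompI.eq_top_of_subset`); the four bottom types with `H = G`: (V) `min = 2` — no;
  (VII) — `|\overline{A + B}| = 2`; (VIII) — `4 ∣ |A + K| = |A| + 4 = 7` (print: «would imply
  `d⊆(A, QP) = 1`»; the divisibility is shorter); (VI) — `|B| = 4`, `A = x₀ + (B ∖ b)`, and after the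
  normalisation `A ↦ A − a`, `B ↦ B + x₀ − a` (with `a ∈ A` off the unique expression element, so that
  «`N₁ᵇ(A, B) = {x + b}`» with `x ≠ 0`) the terminal computation `claim9_terminal`
  (`StepBeyondKempermanThreeFour.lean`) fed by `claim9_exclusions` (`StepBeyondKempermanClaimNineExclusions.lean`,
  displays (47), (50)/(51), transported by `subsetDist_vadd_eq`).

CLAIM 10 (print p. 29): «Claim 10: `|\overline{A + B}| ≥ 4`.  Suppose `|\overline{A + B}| ≤ 3`.  Hence
`d⊆(A + B, P) ≥ 3` (Claim 5) implies that `|\overline{A + B}| = 3`.  Thus Corollary 4.3—which we can apply to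
`(−B, \overline{A + B})` in view of Proposition 2.4, Claims 4 and 9, (45) and (46)—implies that
`d⊆(A, QP ∪ AP) ≤ 1`, a contradiction to (47) or (51).»  Corollary 4.3 is Theorem 4.1 read for the smaller
pair `(−B, \overline{A + B})` (`min = 3 < 4`); here (`Grynkiewicz2009.claim10`) that reading is done directly
on the hypothesis `IH` = Theorem 4.1's conclusion for `(−B, \overline{A + B})` (whose sumset is `\overline{A}`
by Proposition 2.4, `isNonExtendible_iff_neg_add_compl_eq`): (17) is excluded by
`not_seventeen_of_two_le_subsetDist` for `−B` ((47), (50) transported by `subsetDist_neg_eq`); a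
decomposition has `H = G` (`IsGrynkiewiczDecomp.eq_top_of_not_isQuasiPeriodic`), and with `|−B| ≥ 4`,
`|\overline{A + B}| = 3`: type (V) `min = 2` — no; (VI) `|−B| = 3` — no; (VII) forces `|B| = |G| − 6`, i.e.
`|A| = 3` — Claim 9; (VIII) `4 ∣ |\overline{A + B} + K| = 7` — no.

WHAT THIS FILE IS NOT: no new definitions, no named facts; Claim 11 (✓ `StepBeyondKempermanETransform`),
Subcases 1, 2, 4 and the global induction are not here.

## References
* D. J. Grynkiewicz, *A step beyond Kemperman's structure theorem*, Mathematika 55 (2009) 67–114,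
  doi:10.1112/S0025579300000966; §6 Claims 9–10 (pp. 28–29), Lemma 5.11, Cor 4.2–4.3, §4 types (V)–(VIII)
  (held `paper:doi-10-1112-s0025579300000966`, pp. 28–29 read 2026-08-29; arXiv:0710.1041 v2 for the
  overlines) [cite: Grynkiewicz2009, §6 Claim 9].
-/

namespace Literature.Combinatorics.Additive

open Finset
open scoped Pointwise

universe u

variable {G : Type u} [AddCommGroup G] [DecidableEq G]

/-- `(g + A) + (g' + B) = (g + g') + (A + B)`. [folklore] -/
private theorem vadd_add_vadd_eq₉ (A B : Finset G) (g g' : G) :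
    (g +ᵥ A) + (g' +ᵥ B) = (g + g') +ᵥ (A + B) := by
  rw [vadd_add_assoc, add_comm A (g' +ᵥ B), vadd_add_assoc, vadd_vadd, add_comm B A]

namespace IsGrynkiewiczDecomp

/-- «since `⟨A⟩ = G` and since `A` is not quasi-periodic (Claim 4), it follows that `H = G` in Theorem
4.1»: a decomposition of Theorem 4.1 for `(A, B′)` with `0 ∈ A`, `⟨A⟩ = G`, `A` not quasi-periodic has
`H = G`, `A₁ = B₁ = ∅`, `A₀ = A`, `B₀ = B′`. [cite: Grynkiewicz2009, §6 Claim 9 (p. 28)] -/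
theorem eq_top_of_not_isQuasiPeriodic {H : AddSubgroup G} {A B' A₁ A₀ B₁ B₀ : Finset G}
    (hD : IsGrynkiewiczDecomp H A B' A₁ A₀ B₁ B₀) (h0A : (0 : G) ∈ A)
    (hgen : AddSubgroup.closure (A : Set G) = ⊤) (hAqp : ¬ IsQuasiPeriodic A) :
    H = ⊤ ∧ A₁ = ∅ ∧ A₀ = A ∧ B₁ = ∅ ∧ B₀ = B' := by
  obtain ⟨hA₁, hA₀⟩ := hD.decomp_left.left_eq_empty_of_not_isQuasiPeriodic hAqp
  have hHtop : H = ⊤ := by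
    refine Grynkiewicz2009.eq_top_of_coset_of_closure_eq_top (a := 0) h0A hgen fun x hx => ?_
    exact hD.decomp_left.sub_mem x (by rw [hA₀]; exact hx) 0 (by rw [hA₀]; exact h0A)
  subst hHtop
  have hB₁ : B₁ = ∅ := by
    by_contra hne
    obtain ⟨y, hy⟩ := nonempty_iff_ne_empty.2 hne
    obtain ⟨z, hz⟩ := hD.right_nonempty
    have hzB₁ : z ∈ B₁ := by
      have := hD.decomp_right.periodic.add_mem (AddSubgroup.mem_top (z - y)) hy
      rwa [sub_add_cancel] at this
    exact disjoint_left.1 hD.decomp_right.disjoint hzB₁ hz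
  have hB₀ : B₀ = B' := by
    have := hD.decomp_right.union_eq
    rwa [hB₁, empty_union] at this
  exact ⟨rfl, hA₁, hA₀, hB₁, hB₀⟩

end IsGrynkiewiczDecomp

namespace Grynkiewicz2009

/-- «`A + (B ∖ b) = (A + B) ∖ γ` is aperiodic»: a nonempty subset missing at most one element of a set
that is not quasi-periodic is aperiodic (private copy of the lemma of `StepBeyondKempermanSubcaseThree.lean`).
[cite: Grynkiewicz2009, §6 Claim 9 (p. 28)] -/
private theorem addStab_eq_bot_of_card_sdiff_le_one {X Y : Finset G} (hXY : X ⊆ Y) (h1 : #(Y \ X) ≤ 1)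
    (hX : X.Nonempty) (hY : ¬ IsQuasiPeriodic Y) : X.addStab = {0} := by
  by_contra hne
  obtain ⟨H, hH, hHX⟩ := (isPeriodic_iff_addStab_ne hX).2 hne
  apply hY
  rw [← union_sdiff_of_subset hXY]
  refine isQuasiPeriodic_union_of_isPeriodicWith hH hHX hX fun x hx y hy => ?_
  rw [card_le_one.1 h1 x hx y hy, sub_self]
  exact H.zero_mem

/-- The unique expression element `a₁ + b` read off from `r_{A,B}(a₁ + b) = 1`: every expression
`a′ + b″ = a₁ + b` has `a′ = a₁` and `b″ = b`. [cite: Grynkiewicz2009, §2 (`N₁ᵇ(A, B)`)] -/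
theorem eq_of_addConvolution_eq_one {A B : Finset G} {a₁ b a' b'' : G} (ha₁ : a₁ ∈ A) (hb : b ∈ B)
    (h1 : A.addConvolution B (a₁ + b) = 1) (ha' : a' ∈ A) (hb'' : b'' ∈ B)
    (heq : a' + b'' = a₁ + b) : a' = a₁ ∧ b'' = b := by
  unfold Finset.addConvolution at h1
  obtain ⟨p, hp⟩ := card_eq_one.1 h1
  have h₁ : (a₁, b) ∈ ({p} : Finset (G × G)) := by
    rw [← hp, mem_filter, mem_product]; exact ⟨⟨ha₁, hb⟩, rfl⟩
  have h₂ : (a', b'') ∈ ({p} : Finset (G × G)) := by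
    rw [← hp, mem_filter, mem_product]; exact ⟨⟨ha', hb''⟩, heq⟩
  rw [mem_singleton] at h₁ h₂
  have := h₂.trans h₁.symm
  exact ⟨(Prod.mk.inj this).1, (Prod.mk.inj this).2⟩

/-- **§6 Claim 9.**  Under the deep-core standing assumptions with `|A| = 3` — `0 ∈ A ∩ B`, `|B| ≥ 4`,
`|A + B| = |A| + |B|`, `|\overline{A + B}| ≥ 4`, `⟨A⟩ = G`, `d⊆(A, 𝒬𝒫) ≥ 2` (47), `d⊆(A, 𝒬𝒜𝒫_d) ≥ 2` for
all `d ≠ 0` (50), `|N₁ᵇ(A, B)| ≤ 1` for all `b ∈ B` (Claim 8), `A + B` not quasi-periodic (45) — and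
given Theorem 4.1 for the pairs `(A, B ∖ b)` (the induction hypothesis `IH`, see the module docstring):
contradiction.  Proof as printed (module docstring). [cite: Grynkiewicz2009, §6 Claim 9 (pp. 28–29)] -/
theorem claim9 [Fintype G] {A B : Finset G} (h0A : (0 : G) ∈ A) (h0B : (0 : G) ∈ B) (hA3 : #A = 3)
    (hB4 : 4 ≤ #B) (hAB : #(A + B) = #A + #B) (hcompl : 4 ≤ #(A + B)ᶜ)
    (hgen : AddSubgroup.closure (A : Set G) = ⊤)
    (h47 : 2 ≤ subsetDist A {P | IsQuasiPeriodic P})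
    (h50 : ∀ d : G, d ≠ 0 → 2 ≤ subsetDist A {P | IsQuasiProgression d P})
    (hN1 : ∀ b ∈ B, #(layerWith A B 1 {b}) ≤ 1) (h45 : ¬ IsQuasiPeriodic (A + B))
    (IH : ∀ b ∈ B, #(A + B.erase b) = #A + #(B.erase b) → (A + B.erase b).addStab = {0} →
      (∃ α β : G, #(insert α A + insert β (B.erase b)) + 1 =
          #(insert α A) + #(insert β (B.erase b))) ∨
        ∃ (K : AddSubgroup G) (A₁ A₀ B₁ B₀ : Finset G),
          IsGrynkiewiczDecomp K A (B.erase b) A₁ A₀ B₁ B₀) : False := by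
  have hAne : A.Nonempty := ⟨0, h0A⟩
  have hBne : B.Nonempty := ⟨0, h0B⟩
  have hAqp : ¬ IsQuasiPeriodic A := fun hqp => by
    have h0 : subsetDist A {P | IsQuasiPeriodic P} = 0 := subsetDist_eq_zero_iff.2 hqp
    rw [h0] at h47
    exact absurd h47 (by norm_num)
  have hcardG : #(A + B) + #(A + B)ᶜ = Fintype.card G := by
    rw [card_compl]; have := card_le_univ (A + B); omega
  -- «If `|N₁ᵇ(A, B)| = 0` for all `b ∈ B`, then Lemma 5.11 … a contradiction»
  have hex : ∃ b ∈ B, #(layerWith A B 1 {b}) = 1 := by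
    by_contra hnone
    push Not at hnone
    have hzero : ∀ b ∈ B, #(layerWith A B 1 {b}) = 0 := fun b hb => by
      have := hN1 b hb; have := hnone b hb; omega
    have hrep : ∀ c ∈ A + B, 2 ≤ A.addConvolution B c := by
      intro c hc
      have hpos : 0 < A.addConvolution B c := addConvolution_pos.2 hc
      by_contra hlt
      have h1 : A.addConvolution B c = 1 := by omega
      obtain ⟨a, ha, b, hb, rfl⟩ := mem_add.1 hc
      have hcard := hzero b hb
      rw [card_layerWith_one_singleton hb, card_eq_zero, filter_eq_empty_iff] at hcard
      exact hcard ha h1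
    obtain ⟨-, hG⟩ := finite_and_card_le_of_two_le_addConvolution h0A h0B hA3 hgen hrep
    rw [Nat.card_eq_fintype_card, hAB, hA3, show 3 + #B - #B + 1 = 4 by omega,
      show Nat.choose 4 2 = 6 by decide] at hG
    omega
  obtain ⟨b, hb, hNb⟩ := hex
  -- the pair `(A, B ∖ b)`: `A + (B ∖ b) = (A + B) ∖ N₁ᵇ(A, B)`
  set B' := B.erase b with hB'
  have hB'card : #B' = #B - 1 := card_erase_of_mem hb
  have hB'ne : B'.Nonempty := card_pos.1 (by omega)
  have hsplit : A + B' = (A + B) \ layerWithin A B 1 {b} := by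
    have := add_nsmul_add_sdiff_eq (A := A) (B := B) (U := {b}) (i := 1) le_rfl
    rwa [Nat.sub_self, zero_nsmul, add_zero, one_nsmul, sdiff_singleton_eq_erase] at this
  have hWsub : layerWithin A B 1 {b} ⊆ A + B := fun x hx => by
    have := (mem_layerWithin.1 hx).1
    rwa [one_nsmul] at this
  have hWeq : layerWithin A B 1 {b} = layerWith A B 1 {b} := by
    refine Subset.antisymm (fun x hx => ?_) (fun x hx => ?_)
    · rw [mem_layerWithin] at hx
      rw [mem_layerWith]
      refine ⟨hx.1, Subset.antisymm hx.2 ?_⟩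
      -- the trace is nonempty
      have hx1 := hx.1
      rw [one_nsmul] at hx1
      obtain ⟨a, ha, y, hy, rfl⟩ := mem_add.1 hx1
      have hyT : y ∈ repTrace A B 1 (a + y) := by
        rw [mem_repTrace, Nat.sub_self, zero_nsmul, add_zero, add_sub_cancel_right]
        exact ⟨hy, ha⟩
      have := hx.2 hyT
      rw [mem_singleton] at this
      subst this
      exact singleton_subset_iff.2 hyT
    · rw [mem_layerWith] at hx
      rw [mem_layerWithin]
      exact ⟨hx.1, hx.2.le⟩
  have hsub' : A + B' ⊆ A + B := add_subset_add_left (erase_subset b B)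
  have hsdiff : (A + B) \ (A + B') = layerWith A B 1 {b} := by
    rw [hsplit, Finset.sdiff_sdiff_eq_self hWsub, hWeq]
  have hAB' : #(A + B') = #A + #B' := by
    have h := card_sdiff_add_card_eq_card hsub'
    rw [hsdiff, hNb] at h
    omega
  have hap' : (A + B').addStab = {0} :=
    addStab_eq_bot_of_card_sdiff_le_one hsub' (by rw [hsdiff, hNb]) (hAne.add hB'ne) h45
  -- «Therefore we can assume (17) does not hold» for `(A, B ∖ b)`
  have hG : #(A + B') + 3 ≤ Fintype.card G := by
    have := card_le_card hsub'
    omega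
  have hn17 := not_seventeen_of_two_le_subsetDist (B' := B') h0A (by omega) (by omega) hAB' hap'
    hG hgen h47 h50
  -- the induction hypothesis: a decomposition with `H = G`
  rcases IH b hb hAB' hap' with h17 | ⟨K, A₁, A₀, B₁, B₀, hD⟩
  · exact hn17 h17
  obtain ⟨hK, -, hA₀, -, hB₀⟩ := hD.eq_top_of_not_isQuasiPeriodic h0A hgen hAqp
  subst hK
  have hbot := hD.bottom
  rw [hA₀, hB₀, ← hB'] at hbot
  rcases hbot with hV | hVI | hVII | hVIII
  · -- type (V): `min{|A|, |B ∖ b|} = 2`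
    have := hV.1
    omega
  · -- type (VI): `|B| = 4`, `A = x₀ + (B ∖ b)`; normalise and run the terminal computation
    obtain ⟨-, hB'3, ⟨x₀, hAx⟩, -⟩ := hVI
    -- the unique expression element `a₁ + b`
    have hNb' := hNb
    rw [card_layerWith_one_singleton hb] at hNb'
    obtain ⟨a₁, ha₁⟩ := card_eq_one.1 hNb'
    have ha₁mem : a₁ ∈ A.filter fun a => A.addConvolution B (a + b) = 1 := by
      rw [ha₁]; exact mem_singleton_self a₁
    rw [mem_filter] at ha₁mem
    obtain ⟨ha₁A, hue⟩ := ha₁mem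
    -- `B ∖ b = −x₀ + A`
    have hB'eq : B' = (-x₀) +ᵥ A := by rw [hAx, vadd_vadd, neg_add_cancel, zero_vadd]
    -- pick `a ∈ A`, `a ≠ a₁`, and the third element `a₃`
    obtain ⟨a, haA, hane⟩ := exists_mem_ne (by omega : 1 < #A) a₁
    have hcard3 : #((A.erase a).erase a₁) = 1 := by
      rw [card_erase_of_mem (mem_erase.2 ⟨hane.symm, ha₁A⟩), card_erase_of_mem haA, hA3]
    obtain ⟨a₃, ha₃⟩ := card_eq_one.1 hcard3
    have ha₃mem : a₃ ∈ (A.erase a).erase a₁ := by rw [ha₃]; exact mem_singleton_self a₃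
    simp only [mem_erase] at ha₃mem
    obtain ⟨ha₃1, ha₃a, ha₃A⟩ := ha₃mem
    have hAeq : A = {a, a₁, a₃} := by
      ext y
      simp only [mem_insert, mem_singleton]
      constructor
      · intro hy
        by_contra hne
        push Not at hne
        have : y ∈ (A.erase a).erase a₁ := by simp only [mem_erase]; exact ⟨hne.2.1, hne.1, hy⟩
        rw [ha₃, mem_singleton] at this
        exact hne.2.2 this
      · rintro (rfl | rfl | rfl)
        · exact haA
        · exact ha₁A
        · exact ha₃A
    -- the normalised pair
    set d := a₃ - a with hd
    set x := a₁ - a with hx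
    set A₂ := (-a) +ᵥ A with hA₂
    set b₂ := x₀ - a + b with hb₂
    set B₂ := (x₀ - a) +ᵥ B with hB₂
    have hA₂eq : A₂ = {0, d, x} := by
      rw [hA₂, hAeq, vadd_finset_insert, vadd_finset_insert, vadd_finset_singleton, vadd_eq_add,
        vadd_eq_add, vadd_eq_add, neg_add_cancel, hd, hx]
      rw [show -a + a₁ = a₁ - a by abel, show -a + a₃ = a₃ - a by abel]
      ext y; simp only [mem_insert, mem_singleton]; tauto
    have hA₂card : #A₂ = 3 := by rw [hA₂, card_vadd_finset, hA3]
    have hBins : B = insert b B' := (insert_erase hb).symm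
    have hB₂eq : B₂ = insert b₂ A₂ := by
      rw [hB₂, hBins, vadd_finset_insert, hB'eq, vadd_vadd, vadd_eq_add, hb₂, hA₂,
        show x₀ - a + -x₀ = -a by abel]
    have hb₂A : b₂ ∉ A₂ := by
      rw [hA₂, hb₂]
      intro hmem
      obtain ⟨a', ha', heq⟩ := mem_vadd_finset.1 hmem
      rw [vadd_eq_add] at heq
      have hbB' : b ∈ B' := by
        rw [hB'eq]
        refine mem_vadd_finset.2 ⟨a', ha', ?_⟩
        rw [vadd_eq_add]
        have : b = -a + a' - (x₀ - a) := by rw [heq]; abel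
        rw [this]; abel
      exact notMem_erase b B hbB'
    have hAB7 : #(A₂ + B₂) = 7 := by
      rw [hA₂, hB₂, vadd_add_vadd_eq₉, card_vadd_finset, hAB, hA3]
      omega
    have huniq : x + b₂ ∉ A₂ + A₂ := by
      rw [hA₂, vadd_add_vadd_eq₉, hx, hb₂]
      intro hmem
      obtain ⟨z, hz, heq⟩ := mem_vadd_finset.1 hmem
      obtain ⟨a', ha', a'', ha'', rfl⟩ := mem_add.1 hz
      rw [vadd_eq_add] at heq
      -- `a′ + (a″ − x₀) = a₁ + b` with `a″ − x₀ ∈ B ∖ b ⊆ B`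
      have hmemB' : a'' - x₀ ∈ B' := by
        rw [hB'eq]; exact mem_vadd_finset.2 ⟨a'', ha'', by rw [vadd_eq_add]; abel⟩
      have heq' : a' + (a'' - x₀) = a₁ + b := by
        have : a₁ + b = -a + -a + (a' + a'') - (x₀ - a) + a - x₀ + x₀ - x₀ + x₀:= by
          rw [heq]; abel
        rw [this]; abel
      obtain ⟨-, hb''⟩ := eq_of_addConvolution_eq_one ha₁A hb hue ha' (erase_subset b B hmemB') heq'
      rw [hb''] at hmemB'
      exact notMem_erase b B hmemB'
    -- the standing assumptions transported to `A₂ = −a + A`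
    have h47₂ : 2 ≤ subsetDist A₂ {P | IsQuasiPeriodic P} := by
      rw [hA₂, subsetDist_vadd_eq (-a) fun P => isQuasiPeriodic_vadd_iff (-a)]
      exact h47
    have h50₂ : ∀ e : G, e ≠ 0 → 2 ≤ subsetDist A₂ {P | IsQuasiProgression e P} := by
      intro e he
      rw [hA₂, subsetDist_vadd_eq (-a) fun P => isQuasiProgression_vadd_iff]
      exact h50 e he
    obtain ⟨hd0, hx0, hxd, h2d, h2x, h2xd, hx2d, hx3d, hxnd, hxn2d, hd2x, h3d, h3d2x, h2xpd⟩ :=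
      claim9_exclusions hA₂eq hA₂card h47₂ h50₂
    exact claim9_terminal hA₂eq hB₂eq hb₂A hAB7 huniq hd0 hx0 hxd h2d h2x h2xd hx2d hx3d hxnd hxn2d
      hd2x h3d h3d2x h2xpd
  · -- type (VII): `|\overline{A + B}| = 2`
    obtain ⟨K', A'', B'', -, hVI'', hdual⟩ := hVII
    have h6 : #(A'' + B'') = 6 := by rw [hVI''.card_add, hVI''.1, hVI''.2.1]
    have h6le : #(A'' + B'') ≤ Fintype.card G := card_le_univ _
    have hle' : #(A + B') ≤ #(A + B) := card_le_card hsub'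
    obtain ⟨a, -, c, -, hA''K, -, -, -, hcases⟩ := hdual
    rcases hcases with ⟨g, g', hAg, hB'iff⟩ | ⟨g, g', hB'g, hAiff⟩
    · -- `A = g − A″`, so `K′ = G` and `B ∖ b = g′ + \overline{A″ + B″}`
      have hK'top : K' = ⊤ := by
        refine eq_top_of_coset_of_closure_eq_top (a := g - a) h0A hgen fun y hy => ?_
        rw [hAg] at hy
        obtain ⟨z, hz, rfl⟩ := mem_vadd_finset.1 hy
        rw [mem_neg'] at hz
        have h1 := K'.neg_mem (hA''K (-z) hz)
        have : (g +ᵥ z) - (g - a) = -((-z) - a) := by rw [vadd_eq_add]; abel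
        rwa [this]
      subst hK'top
      have hB'eq2 : B' = g' +ᵥ (A'' + B'')ᶜ := by
        ext z
        rw [hB'iff z, mem_vadd_finset]
        constructor
        · rintro ⟨-, hz⟩
          exact ⟨z - g', mem_compl.2 hz, by rw [vadd_eq_add]; abel⟩
        · rintro ⟨y, hy, rfl⟩
          refine ⟨AddSubgroup.mem_top _, ?_⟩
          rw [vadd_eq_add, add_sub_cancel_left]
          exact mem_compl.1 hy
      have hB'c : #B' = Fintype.card G - 6 := by rw [hB'eq2, card_vadd_finset, card_compl, h6]
      omega
    · -- `B ∖ b = g − B″` and `A = g′ + \overline{A″ + B″}`, so `K′ = G`, `|G| = 9`, `|B| = 4`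
      have hK'top : K' = ⊤ := by
        refine eq_top_of_coset_of_closure_eq_top (a := g' + (a + c)) h0A hgen fun y hy => ?_
        have := ((hAiff y).1 hy).1
        rwa [sub_sub] at this
      subst hK'top
      have hAeq2 : A = g' +ᵥ (A'' + B'')ᶜ := by
        ext z
        rw [hAiff z, mem_vadd_finset]
        constructor
        · rintro ⟨-, hz⟩
          exact ⟨z - g', mem_compl.2 hz, by rw [vadd_eq_add]; abel⟩
        · rintro ⟨y, hy, rfl⟩
          refine ⟨AddSubgroup.mem_top _, ?_⟩
          rw [vadd_eq_add, add_sub_cancel_left]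
          exact mem_compl.1 hy
      have hAc : #A = Fintype.card G - 6 := by rw [hAeq2, card_vadd_finset, card_compl, h6]
      have hB'c : #B' = 3 := by rw [hB'g, card_vadd_finset, card_neg, hVI''.2.1]
      omega
  · -- type (VIII): `|A + K| = |A| + 4 = 7` is not a multiple of `|K| = 4`
    obtain ⟨-, -, -, K', Kf, hKf, hKf4, -, a, b', d, m, n, -, -, -, -, hAK, -, -, hcardA, -⟩ := hVIII
    have hper : IsPeriodicWith K' (A + Kf) := by
      intro k hk
      refine eq_of_subset_of_card_le (fun y hy => ?_) (by rw [card_vadd_finset])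
      obtain ⟨z, hz, rfl⟩ := mem_vadd_finset.1 hy
      obtain ⟨a', ha', k', hk', rfl⟩ := mem_add.1 hz
      rw [vadd_eq_add, ← add_assoc, add_comm k a', add_assoc]
      exact add_mem_add ha' ((hKf _).2 (K'.add_mem hk ((hKf k').1 hk')))
    have hdvd := card_eq_cosetCount_mul hKf hper
    rw [hcardA, hA3, hKf4] at hdvd
    omega


/-- **§6 Claim 10: `|\overline{A + B}| ≥ 4`.**  Under the deep-core standing assumptions after Claim 9 —
`0 ∈ B`, `|A|, |B| ≥ 4`, `|A + B| = |A| + |B|`, `|\overline{A + B}| ≥ 3` (Claim 5), `A` non-extendible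
w.r.t. `B` (for Proposition 2.4), `A` aperiodic ((48)), `⟨B⟩ = G`, `d⊆(B, 𝒬𝒫) ≥ 2` (47) and
`d⊆(B, 𝒬𝒜𝒫_d) ≥ 2` for `d ≠ 0` (50) — and given Theorem 4.1 for the smaller pair `(−B, \overline{A + B})`
(the hypothesis `IH`; print: «Corollary 4.3—which we can apply to `(−B, \overline{A + B})`»):
`|\overline{A + B}| ≥ 4`.  See the module docstring. [cite: Grynkiewicz2009, §6 Claim 10 (p. 29)] -/
theorem claim10 [Fintype G] {A B : Finset G} (h0B : (0 : G) ∈ B) (hA4 : 4 ≤ #A) (hB4 : 4 ≤ #B)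
    (hAB : #(A + B) = #A + #B) (hc3 : 3 ≤ #(A + B)ᶜ) (hneA : IsNonExtendible A B)
    (haper : A.addStab = {0}) (hgenB : AddSubgroup.closure (B : Set G) = ⊤)
    (h47B : 2 ≤ subsetDist B {P | IsQuasiPeriodic P})
    (h50B : ∀ d : G, d ≠ 0 → 2 ≤ subsetDist B {P | IsQuasiProgression d P})
    (IH : #(-B + (A + B)ᶜ) = #(-B) + #(A + B)ᶜ → (-B + (A + B)ᶜ).addStab = {0} →
      (∃ α β : G, #(insert α (-B) + insert β (A + B)ᶜ) + 1 = #(insert α (-B)) + #(insert β (A + B)ᶜ)) ∨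
        ∃ (K : AddSubgroup G) (A₁ A₀ B₁ B₀ : Finset G),
          IsGrynkiewiczDecomp K (-B) (A + B)ᶜ A₁ A₀ B₁ B₀) :
    4 ≤ #(A + B)ᶜ := by
  by_contra hlt
  have hc : #(A + B)ᶜ = 3 := by omega
  have hAne : A.Nonempty := card_pos.1 (by omega)
  have hBne : B.Nonempty := ⟨0, h0B⟩
  have hcardG : #(A + B) + #(A + B)ᶜ = Fintype.card G := by
    rw [card_compl]; have := card_le_univ (A + B); omega
  have hAsub : A ⊆ A + B := fun a ha => by
    have := add_mem_add ha h0B; rwa [add_zero] at this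
  -- the pair `(X, Y) = (−B, \overline{A + B})` with sumset `\overline{A}`
  set X := -B with hX
  set Y := (A + B)ᶜ with hY
  have hXc : #X = #B := card_neg B
  have h0X : (0 : G) ∈ X := by rw [hX, mem_neg']; simpa using h0B
  have hXY : X + Y = Aᶜ := isNonExtendible_iff_neg_add_compl_eq.1 hneA
  have hcA : #Aᶜ = Fintype.card G - #A := card_compl A
  have hcardXY : #(X + Y) = #X + #Y := by
    rw [hXY, hcA, hXc, hc]
    have := card_le_univ (A + B)
    omega
  have hAcne : (Aᶜ : Finset G).Nonempty := card_pos.1 (by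
    have := card_le_card (compl_subset_compl.2 hAsub); omega)
  have haperXY : (X + Y).addStab = {0} := by
    rw [hXY]
    by_contra hne
    have hcard : 1 < #(Aᶜ : Finset G).addStab := by
      have h0 : (0 : G) ∈ (Aᶜ : Finset G).addStab := hAcne.zero_mem_addStab
      by_contra hle
      push Not at hle
      have : #(Aᶜ : Finset G).addStab = 1 := le_antisymm hle (card_pos.2 ⟨0, h0⟩)
      obtain ⟨g, hg⟩ := card_eq_one.1 this
      rw [hg, mem_singleton] at h0
      exact hne (by rw [hg, h0])
    obtain ⟨g, hg, hg0⟩ := exists_mem_ne hcard (0 : G)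
    rw [mem_addStab hAcne] at hg
    have hgA : g +ᵥ A = A := by
      refine eq_of_subset_of_card_le (fun y hy => ?_) (by rw [card_vadd_finset])
      obtain ⟨a, ha, rfl⟩ := mem_vadd_finset.1 hy
      by_contra hnot
      have h1 : g +ᵥ a ∈ g +ᵥ (Aᶜ : Finset G) := by rw [hg]; exact mem_compl.2 hnot
      rw [vadd_mem_vadd_finset_iff] at h1
      exact (mem_compl.1 h1) ha
    have : g ∈ A.addStab := (mem_addStab hAne).2 hgA
    rw [haper, mem_singleton] at this
    exact hg0 this
  have hG : #(X + Y) + 3 ≤ Fintype.card G := by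
    rw [hXY, hcA]
    have := card_le_univ A
    omega
  have hgenX : AddSubgroup.closure (X : Set G) = ⊤ := by
    rw [hX, coe_neg, AddSubgroup.closure_neg]; exact hgenB
  have h47X : 2 ≤ subsetDist X {P | IsQuasiPeriodic P} := by
    rw [hX, subsetDist_neg_eq fun P => isQuasiPeriodic_neg_iff]; exact h47B
  have h50X : ∀ e : G, e ≠ 0 → 2 ≤ subsetDist X {P | IsQuasiProgression e P} := fun e he => by
    rw [hX, subsetDist_neg_eq fun P => isQuasiProgression_neg_iff]; exact h50B e he
  have hXqp : ¬ IsQuasiPeriodic X := fun hqp => by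
    have h0 : subsetDist X {P | IsQuasiPeriodic P} = 0 := subsetDist_eq_zero_iff.2 hqp
    rw [h0] at h47X
    exact absurd h47X (by norm_num)
  -- «(17) does not hold» for `(−B, \overline{A + B})`
  have hn17 := not_seventeen_of_two_le_subsetDist (A := X) (B' := Y) h0X (by omega) (by omega)
    hcardXY haperXY hG hgenX h47X h50X
  rcases IH hcardXY haperXY with h17 | ⟨K, X₁, X₀, Y₁, Y₀, hD⟩
  · exact hn17 h17
  obtain ⟨hK, -, hX₀, -, hY₀⟩ := hD.eq_top_of_not_isQuasiPeriodic h0X hgenX hXqp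
  subst hK
  have hbot := hD.bottom
  rw [hX₀, hY₀] at hbot
  rcases hbot with hV | hVI | hVII | hVIII
  · have := hV.1
    omega
  · have := hVI.1
    omega
  · obtain ⟨K', A'', B'', -, hVI'', hdual⟩ := hVII
    have h6 : #(A'' + B'') = 6 := by rw [hVI''.card_add, hVI''.1, hVI''.2.1]
    have h6le : #(A'' + B'') ≤ Fintype.card G := card_le_univ _
    obtain ⟨a, -, c, -, -, -, -, -, hcases⟩ := hdual
    rcases hcases with ⟨g, g', hXg, -⟩ | ⟨g, g', -, hXiff⟩
    · have : #X = 3 := by rw [hXg, card_vadd_finset, card_neg, hVI''.1]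
      omega
    · have hK'top : K' = ⊤ := by
        refine eq_top_of_coset_of_closure_eq_top (a := g' + (a + c)) h0X hgenX fun y hy => ?_
        have := ((hXiff y).1 hy).1
        rwa [sub_sub] at this
      subst hK'top
      have hXeq2 : X = g' +ᵥ (A'' + B'')ᶜ := by
        ext z
        rw [hXiff z, mem_vadd_finset]
        constructor
        · rintro ⟨-, hz⟩
          exact ⟨z - g', mem_compl.2 hz, by rw [vadd_eq_add]; abel⟩
        · rintro ⟨y, hy, rfl⟩
          refine ⟨AddSubgroup.mem_top _, ?_⟩
          rw [vadd_eq_add, add_sub_cancel_left]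
          exact mem_compl.1 hy
      have hXc2 : #X = Fintype.card G - 6 := by rw [hXeq2, card_vadd_finset, card_compl, h6]
      omega
  · obtain ⟨-, -, -, K', Kf, hKf, hKf4, -, a, b', d, m, n, -, -, -, -, -, -, -, -, hcardY, -⟩ := hVIII
    have hper : IsPeriodicWith K' (Y + Kf) := by
      intro k hk
      refine eq_of_subset_of_card_le (fun y hy => ?_) (by rw [card_vadd_finset])
      obtain ⟨z, hz, rfl⟩ := mem_vadd_finset.1 hy
      obtain ⟨a', ha', k', hk', rfl⟩ := mem_add.1 hz
      rw [vadd_eq_add, ← add_assoc, add_comm k a', add_assoc]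
      exact add_mem_add ha' ((hKf _).2 (K'.add_mem hk ((hKf k').1 hk')))
    have hdvd := card_eq_cosetCount_mul hKf hper
    rw [hcardY, hc, hKf4] at hdvd
    omega

end Grynkiewicz2009

end Literature.Combinatorics.Additive
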